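/-
Copyright (c) 2026 the pub-hodgecm-mathlib formalisation cell (harness21).  Prover seat hodgecm-mathlib-F0P3a-p08 (g20): road «S3-ram» (LEAD F0P3a-plan (g13);
owner F0P3a-p06 (g15)), (T2) G-side organ (Cnt2′) (chair F0P3a-p07 (g14)), ROW SOCKET `T2G_reg` — organ (N′) of the lattice PARENT LAW «q · n_reg = n_bd»; 2026-09-02.
-/
import Literature.NumberTheory.Automorphic.UnitaryLatticeTreeNilpotencyTokenOfDepths   -- ★ ROW-N (F0P3-p03 (g15)): `inv_mul_pow_three_mul_eq_pow`, `v_mul_apply_le_of_forall_v_le`; brings ★ FILE H `map_toLin'_latt_le_scaleLattice_iff`, `inv_mul_sq_mul_eq_sq`, Cayley–Hamilton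
import Literature.NumberTheory.Automorphic.UnitaryLatticeTreeCharpolyCongruence         -- ★ (F0P3-p03 (g13)): `exists_map_subtype_eq_of_isIntMatrix`
import HarnessLib

/-!
# The lattice graph of a hermitian space — THE NILPOTENCY TOKEN OF A `ϖ²`-DEEP ELEMENT: if `γ ≡ 1 (mod ϖ²)` in the root frame and `γ − 1` has level `ϖ^d` on a lattice, `d ≤ 1`,
# then `(γ − 1)³` has level `ϖ^{3d+1}` on it — Cayley–Hamilton with graded coefficient bounds (Kottwitz 1986 §3; Lang, *Algebra* XIV §3)

Topic `NumberTheory/Automorphic`; namespace `Literature.NumberTheory.Automorphic.UnitaryLatticeTree`.  THEOREMS ONLY (no definition, no instance, no notation, no named fact,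
no `sorry`); kernel lane `--supports stmt-HodgeConjecture-24833`; datum-free (`K` with `Valued K ℤᵐ⁰`; any `3 × 3` matrix `γ`, no form, no `σ` in §1–§2).  Cell
`pub/hodgecm-mathlib` (D-0151), crux H413; road «S3-ram» (Literature seeding, count-neutral); (T2) G-side organ (Cnt2′) of the fold, ROW SOCKET `T2G_reg` (this seat), organ
**(N′)** of the lattice PARENT LAW «`q · n_reg = n_bd`» (statement-first `UnitaryLatticeTreeFixedParentLawRamified`, HOME `F0/P3a/F0P3a-p08/g20/reg/`): the `hnil` hypotheses of
★ `fixedGrandchildren_eq_empty_of_levelZero` (`LEV₃[v] ϖ` at depth `0`) and of ★ ROW-R ∕ ROW-C (`LEV₃[v](ϖ⁴)` at depth `1`) for a literal that is `ϖ²`-DEEP AT THE ROOT — the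
only information the parent law keeps about the type-(2) literal (twin of ★ ROW-N, which reads `hnil` from the EIGENVALUE depths of a type-(1) literal instead).

THE MATHEMATICS.  Let `N = γ − 1` with all entries `|N_{ij}| ≤ |c|`, `|c| ≤ 1` (here `c = ϖ²`).  Over `𝒪 = 𝒪[K]` the entries lie in the ideal `(c)`, so by the graded
Cayley–Hamilton bookkeeping (Mathlib `Matrix.coeff_charpoly_mem_ideal_pow`) the coefficient of `X^k` in `χ_N` lies in `(c)^{3−k}`: **`|χ_N.coeff k| ≤ |c|^{3−k}`** (§1).
Cayley–Hamilton `N³ = −(a₂N² + a₁N + a₀)` (`a_k = χ_N.coeff k`) is preserved by conjugation `N ↦ N′ = G⁻¹NG`; if `N′` is `ϖ^d`-integral then `N′²` is `ϖ^{2d}`-integral and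
**`|(N′³)_{ij}| ≤ max(|ϖ|^{4+2d}, |ϖ|^{8+d}, |ϖ|^{12})^{1/2}`** … precisely `≤ max(|ϖ|²·|ϖ|^{2d}, |ϖ|⁴·|ϖ|^d, |ϖ|⁶) ≤ |ϖ|^{3d+1}` as soon as `d ≤ 1` (§2) — the token
**`LEV₃[latt G](ϖ^{3d+1})`** from `LEV[latt G](ϖ^d)` (§3, ★ FILE H `map_toLin'_latt_le_scaleLattice_iff`).  (For `d ≥ 2` the `ϖ²`-depth at the root is too weak; the parent
law only needs `d ∈ {0, 1}`.)

* §1 `v_charpoly_coeff_le_pow_of_forall_v_le` (graded coefficient bounds), `pow_three_eq_neg_of_charpoly_three` (Cayley–Hamilton for a `3 × 3` matrix, coefficient form),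
  `conj_pow_three_eq_neg_of_charpoly_three` (the same for `G⁻¹NG`).
* §2 **`v_conj_sub_one_pow_three_apply_le_of_twoDeep`** (matrix level).
* §3 **`map_sub_one_pow_three_latt_le_scaleLattice_of_twoDeep`** (token at `latt g`), `…_of_isVertex` (any vertex of any `latticeGraph σ ϖ H`), and the two PARENT-LAW
  spellings at a vertex of the `J₀`-graph: `map_sub_one_pow_three_le_scaleLattice_of_twoDeep_of_lev` (`LEV[w] ϖ ⇒ LEV₃[w](ϖ⁴)`) and
  `map_sub_one_pow_three_le_scaleLattice_of_twoDeep_of_fixed` (`γ·w = w ⇒ LEV₃[w] ϖ`).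

HONEST LABEL: HC_CM is proved only modulo the 2 remaining named inputs (hLiu418 24832, h413 24833) until rung 0 closes; nothing printed is asserted here (Cayley–Hamilton over a
field and ultrametric entry bounds); «S3-ram» has no books consequence.

## References
* [Kottwitz1986] R. E. Kottwitz, *Base change for unit elements of Hecke algebras*, Compositio Math. 60 (1986), §3 (levels of a compact element on fixed lattices).
* [Lang2002] S. Lang, *Algebra*, rev. 3rd ed., GTM 211 (2002), Ch. XIV §3 pp. 561–563 (the characteristic polynomial: coefficients as polynomial functions of the entries,
  Cayley–Hamilton).
* [Serre1980Trees] J.-P. Serre, *Trees* (1980), Ch. II §1.1 (lattices and levels).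
-/

set_option autoImplicit false

noncomputable section

open scoped Valued WithZero Matrix MatrixGroups
open Polynomial

namespace Literature.NumberTheory.Automorphic.UnitaryLatticeTree

open Literature.NumberTheory.Automorphic Literature.NumberTheory.Automorphic.HermitianLattice

variable {K : Type*} [Field K] [Valued K ℤᵐ⁰]

/-! ## §1 Graded coefficient bounds and Cayley–Hamilton in coefficient form -/

/-- **GRADED COEFFICIENT BOUNDS.**  If every entry of the `3 × 3` matrix `N` satisfies `|N_{ij}| ≤ |c|` with `|c| ≤ 1`, then `|χ_N.coeff k| ≤ |c|^{3−k}` (over `𝒪[K]` the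
entries lie in the ideal `(c)`, and Mathlib's `Matrix.coeff_charpoly_mem_ideal_pow` puts `coeff k` in `(c)^{3−k} = (c^{3−k})`). [cite: Lang2002, Ch. XIV §3 p. 561] -/
theorem v_charpoly_coeff_le_pow_of_forall_v_le {N : Matrix (Fin 3) (Fin 3) K} {c : K} (hc : Valued.v c ≤ 1) (hN : ∀ i j, Valued.v (N i j) ≤ Valued.v c) (k : ℕ) :
    Valued.v (N.charpoly.coeff k) ≤ Valued.v c ^ (3 - k) := by
  by_cases hc0 : c = 0
  · -- `N = 0`, `χ_0 = X³`
    have hN0 : N = 0 := by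
      ext i j
      have h := hN i j
      rw [hc0, map_zero, le_zero_iff] at h
      exact (map_eq_zero _).1 h
    rw [hN0, hc0, map_zero]
    have hchar : (0 : Matrix (Fin 3) (Fin 3) K).charpoly = X ^ 3 := by
      rw [show (0 : Matrix (Fin 3) (Fin 3) K) = Matrix.diagonal (fun _ => (0 : K)) from Matrix.diagonal_zero.symm, Matrix.charpoly_diagonal]
      simp
    rw [hchar, Polynomial.coeff_X_pow]
    by_cases hk : k = 3
    · subst hk; simp
    · rw [if_neg hk, map_zero]; exact zero_le
  -- lift to `𝒪`
  have hNint : IsIntMatrix N := fun i j => (hN i j).trans hc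
  obtain ⟨N₀, hN₀⟩ := exists_map_subtype_eq_of_isIntMatrix hNint
  let c₀ : 𝒪[K] := ⟨c, hc⟩
  -- the entries of `N₀` lie in the ideal `(c₀)`
  have hmem : ∀ i j, N₀ i j ∈ Ideal.span ({c₀} : Set 𝒪[K]) := by
    intro i j
    rw [Ideal.mem_span_singleton']
    have hij : ((N₀ i j : 𝒪[K]) : K) = N i j := by rw [← hN₀]; rfl
    refine ⟨⟨N i j * c⁻¹, (Valuation.mem_integer_iff _ _).2 ?_⟩, Subtype.ext ?_⟩
    · rw [map_mul, map_inv₀]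
      calc Valued.v (N i j) * (Valued.v c)⁻¹ ≤ Valued.v c * (Valued.v c)⁻¹ := mul_le_mul' (hN i j) le_rfl
        _ = 1 := mul_inv_cancel₀ (fun h0 => hc0 ((map_eq_zero _).1 h0))
    · change N i j * c⁻¹ * c = ((N₀ i j : 𝒪[K]) : K)
      rw [hij, inv_mul_cancel_right₀ hc0]
  have hcoeff := Matrix.coeff_charpoly_mem_ideal_pow hmem k
  rw [Fintype.card_fin, Ideal.span_singleton_pow, Ideal.mem_span_singleton'] at hcoeff
  obtain ⟨a, ha⟩ := hcoeff
  have hK : N.charpoly.coeff k = ((a : 𝒪[K]) : K) * c ^ (3 - k) := by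
    rw [← hN₀, Matrix.charpoly_map, Polynomial.coeff_map, ← ha]
    rfl
  rw [hK, map_mul, map_pow]
  exact mul_le_of_le_one_left zero_le a.2

omit [Valued K ℤᵐ⁰] in
/-- **CAYLEY–HAMILTON, `3 × 3`, coefficient form**: `N³ = −(a₂•N² + a₁•N + a₀•1)`, `a_k = χ_N.coeff k`. [cite: Lang2002, Ch. XIV §3 p. 561] -/
theorem pow_three_eq_neg_of_charpoly_three (N : Matrix (Fin 3) (Fin 3) K) :
    N ^ 3 = -(N.charpoly.coeff 2 • N ^ 2 + N.charpoly.coeff 1 • N + N.charpoly.coeff 0 • (1 : Matrix (Fin 3) (Fin 3) K)) := by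
  have hCH := Matrix.aeval_self_charpoly N
  have hmonic := Matrix.charpoly_monic N
  have hdeg : N.charpoly.natDegree = 3 := by rw [Matrix.charpoly_natDegree_eq_dim, Fintype.card_fin]
  rw [hmonic.as_sum, hdeg] at hCH
  simp only [map_add, map_pow, aeval_X, map_mul, aeval_C, map_one, Finset.sum_range_succ, Finset.sum_range_zero, zero_add, pow_zero, pow_one,
    Algebra.algebraMap_eq_smul_one, smul_mul_assoc, one_mul] at hCH
  rw [eq_neg_iff_add_eq_zero, ← hCH]
  abel

omit [Valued K ℤᵐ⁰] in
/-- The same identity for the conjugate `N′ = G⁻¹NG` (conjugation is a ring homomorphism commuting with scalars; `χ_{N′}`-free form: the coefficients are those of `χ_N`).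
[cite: Lang2002, Ch. XIV §3 p. 562] -/
theorem conj_pow_three_eq_neg_of_charpoly_three (N : Matrix (Fin 3) (Fin 3) K) {G : Matrix (Fin 3) (Fin 3) K} (hG : IsUnit G.det) :
    (G⁻¹ * N * G) ^ 3 = -(N.charpoly.coeff 2 • (G⁻¹ * N * G) ^ 2 + N.charpoly.coeff 1 • (G⁻¹ * N * G) + N.charpoly.coeff 0 • (1 : Matrix (Fin 3) (Fin 3) K)) := by
  rw [← inv_mul_pow_three_mul_eq_pow _ hG, ← inv_mul_sq_mul_eq_sq _ hG, pow_three_eq_neg_of_charpoly_three N]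
  rw [Matrix.mul_neg, Matrix.neg_mul, Matrix.mul_add, Matrix.mul_add, Matrix.add_mul, Matrix.add_mul, Matrix.mul_smul, Matrix.mul_smul, Matrix.mul_smul,
    Matrix.smul_mul, Matrix.smul_mul, Matrix.smul_mul, Matrix.mul_one, Matrix.nonsing_inv_mul _ hG]

/-! ## §2 The matrix level: `|γ − 1| ≤ |ϖ|²`, `|G⁻¹(γ − 1)G| ≤ |ϖ|^d`, `d ≤ 1` ⇒ `|(G⁻¹(γ − 1)G)³| ≤ |ϖ|^{3d+1}` -/

/-- **MATRIX LEVEL OF THE `ϖ²`-DEEP NILPOTENCY TOKEN.**  If all entries of `N = γ − 1` are `≤ |ϖ|²` (`|ϖ| ≤ 1`) and the conjugate `N′ = G⁻¹NG` is `ϖ^d`-integral with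
`d ≤ 1`, then `N′³` is `ϖ^{3d+1}`-integral: `N′³ = −(a₂N′² + a₁N′ + a₀)` with `|a₂| ≤ |ϖ|²`, `|a₁| ≤ |ϖ|⁴`, `|a₀| ≤ |ϖ|⁶` (§1), `|N′²| ≤ |ϖ|^{2d}`.
[cite: Kottwitz1986, §3] [cite: Lang2002, Ch. XIV §3 p. 561] -/
theorem v_conj_sub_one_pow_three_apply_le_of_twoDeep {ϖ : K} (hϖ1 : Valued.v ϖ ≤ 1) {γm : Matrix (Fin 3) (Fin 3) K}
    (hγ2 : ∀ i j, Valued.v ((γm - 1) i j) ≤ Valued.v ϖ ^ 2) {d : ℕ} (hd : d ≤ 1)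
    {G : Matrix (Fin 3) (Fin 3) K} (hG : IsUnit G.det) (hN : ∀ i j, Valued.v ((G⁻¹ * (γm - 1) * G) i j) ≤ Valued.v ϖ ^ d) (i j : Fin 3) :
    Valued.v (((G⁻¹ * (γm - 1) * G) ^ 3 : Matrix (Fin 3) (Fin 3) K) i j) ≤ Valued.v ϖ ^ (3 * d + 1) := by
  have hpow : ∀ {m n : ℕ}, n ≤ m → Valued.v ϖ ^ m ≤ Valued.v ϖ ^ n := fun {m n} h => pow_le_pow_right_of_le_one' hϖ1 h
  set N := γm - 1 with hNdef
  set N' := G⁻¹ * N * G with hN'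
  -- coefficient bounds `|a_k| ≤ |ϖ²|^{3−k}`
  have hc : Valued.v (ϖ ^ 2) ≤ 1 := by rw [map_pow]; exact pow_le_one' hϖ1 2
  have hγ2' : ∀ i j, Valued.v (N i j) ≤ Valued.v (ϖ ^ 2) := fun i j => by rw [map_pow]; exact hγ2 i j
  have ha : ∀ k, Valued.v (N.charpoly.coeff k) ≤ Valued.v ϖ ^ (2 * (3 - k)) := fun k => by
    have h := v_charpoly_coeff_le_pow_of_forall_v_le hc hγ2' k
    rwa [map_pow, ← pow_mul] at h
  have hsq : ∀ i j, Valued.v ((N' ^ 2 : Matrix (Fin 3) (Fin 3) K) i j) ≤ Valued.v ϖ ^ d * Valued.v ϖ ^ d := fun i j => by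
    rw [pow_two]; exact v_mul_apply_le_of_forall_v_le hN hN i j
  have hone : ∀ i j : Fin 3, Valued.v ((1 : Matrix (Fin 3) (Fin 3) K) i j) ≤ 1 := fun i j => by
    rw [Matrix.one_apply]; split_ifs <;> simp
  rw [conj_pow_three_eq_neg_of_charpoly_three N hG, Matrix.neg_apply, Valuation.map_neg, Matrix.add_apply, Matrix.add_apply,
    Matrix.smul_apply, Matrix.smul_apply, Matrix.smul_apply, smul_eq_mul, smul_eq_mul, smul_eq_mul]
  refine (Valuation.map_add _ _ _).trans (max_le ((Valuation.map_add _ _ _).trans (max_le ?_ ?_)) ?_)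
  · rw [map_mul]
    calc Valued.v (N.charpoly.coeff 2) * Valued.v ((N' ^ 2 : Matrix (Fin 3) (Fin 3) K) i j)
        ≤ Valued.v ϖ ^ (2 * (3 - 2)) * (Valued.v ϖ ^ d * Valued.v ϖ ^ d) := mul_le_mul' (ha 2) (hsq i j)
      _ = Valued.v ϖ ^ (2 + 2 * d) := by rw [← pow_add, ← pow_add]; congr 1; omega
      _ ≤ Valued.v ϖ ^ (3 * d + 1) := hpow (by omega)
  · rw [map_mul]
    calc Valued.v (N.charpoly.coeff 1) * Valued.v (N' i j)
        ≤ Valued.v ϖ ^ (2 * (3 - 1)) * Valued.v ϖ ^ d := mul_le_mul' (ha 1) (hN i j)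
      _ = Valued.v ϖ ^ (4 + d) := by rw [← pow_add]
      _ ≤ Valued.v ϖ ^ (3 * d + 1) := hpow (by omega)
  · rw [map_mul]
    calc Valued.v (N.charpoly.coeff 0) * Valued.v ((1 : Matrix (Fin 3) (Fin 3) K) i j)
        ≤ Valued.v ϖ ^ (2 * (3 - 0)) * 1 := mul_le_mul' (ha 0) (hone i j)
      _ = Valued.v ϖ ^ 6 := by rw [mul_one]
      _ ≤ Valued.v ϖ ^ (3 * d + 1) := hpow (by omega)

/-! ## §3 The token `LEV₃(ϖ^{3d+1})` from `LEV(ϖ^d)`, `d ≤ 1`, for a `ϖ²`-deep element -/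

/-- **TOKEN FORM at `latt g`**: if `|γ − 1| ≤ |ϖ|²` entrywise (`|ϖ| ≤ 1`, `ϖ ≠ 0`), `d ≤ 1`, and `γ − 1` has level `ϖ^d` on `latt g`, then `(γ − 1)³` has level `ϖ^{3d+1}`
on it. [cite: Kottwitz1986, §3] [cite: Serre1980Trees, II.1.1] -/
theorem map_sub_one_pow_three_latt_le_scaleLattice_of_twoDeep {ϖ : K} (hϖ1 : Valued.v ϖ ≤ 1) (hϖ0 : ϖ ≠ 0) {γm : Matrix (Fin 3) (Fin 3) K}
    (hγ2 : ∀ i j, Valued.v ((γm - 1) i j) ≤ Valued.v ϖ ^ 2) {d : ℕ} (hd : d ≤ 1) (g : GL (Fin 3) K)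
    (hlev : (latt (g : Matrix (Fin 3) (Fin 3) K)).map ((Matrix.toLin' (γm - 1)).restrictScalars 𝒪[K]) ≤ scaleLattice (ϖ ^ d) (latt (g : Matrix (Fin 3) (Fin 3) K))) :
    (latt (g : Matrix (Fin 3) (Fin 3) K)).map ((Matrix.toLin' ((γm - 1) ^ 3)).restrictScalars 𝒪[K]) ≤
      scaleLattice (ϖ ^ (3 * d + 1)) (latt (g : Matrix (Fin 3) (Fin 3) K)) := by
  have hG : IsUnit (g : Matrix (Fin 3) (Fin 3) K).det := Matrix.isUnits_det_units g
  have hN : ∀ i j, Valued.v (((g : Matrix (Fin 3) (Fin 3) K)⁻¹ * (γm - 1) * (g : Matrix (Fin 3) (Fin 3) K)) i j) ≤ Valued.v ϖ ^ d := by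
    intro i j
    have h := (map_toLin'_latt_le_scaleLattice_iff (pow_ne_zero _ hϖ0) (γm - 1) hG).1 hlev i j
    rwa [map_pow] at h
  rw [map_toLin'_latt_le_scaleLattice_iff (pow_ne_zero _ hϖ0) _ hG, inv_mul_pow_three_mul_eq_pow _ hG]
  intro i j
  rw [map_pow]
  exact v_conj_sub_one_pow_three_apply_le_of_twoDeep hϖ1 hγ2 hd hG hN i j

/-- **At a VERTEX of any lattice graph** (a vertex is `latt g` for some `g ∈ GL₃(K)`), with the tree's uniformiser token `|ϖ| = exp(−1)`.
[cite: Kottwitz1986, §3] [cite: Serre1980Trees, II.1.1] -/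
theorem map_sub_one_pow_three_le_scaleLattice_of_twoDeep_of_isVertex {σ : K →+* K} {ϖ : K} (hϖ : Valued.v ϖ = WithZero.exp (-1 : ℤ))
    {H : Matrix (Fin 3) (Fin 3) K} {γm : Matrix (Fin 3) (Fin 3) K} (hγ2 : ∀ i j, Valued.v ((γm - 1) i j) ≤ Valued.v ϖ ^ 2) {d : ℕ} (hd : d ≤ 1)
    {M : Submodule 𝒪[K] (Fin 3 → K)} (hM : IsVertex σ ϖ H M) (hlev : M.map ((Matrix.toLin' (γm - 1)).restrictScalars 𝒪[K]) ≤ scaleLattice (ϖ ^ d) M) :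
    M.map ((Matrix.toLin' ((γm - 1) ^ 3)).restrictScalars 𝒪[K]) ≤ scaleLattice (ϖ ^ (3 * d + 1)) M := by
  have hϖ0 : ϖ ≠ 0 := fun h0 => by rw [h0, map_zero] at hϖ; exact WithZero.coe_ne_zero hϖ.symm
  have hϖ1 : Valued.v ϖ ≤ 1 := by rw [hϖ, ← WithZero.exp_zero]; exact WithZero.exp_le_exp.2 (by norm_num)
  obtain ⟨_, g, rfl, -⟩ := hM
  exact map_sub_one_pow_three_latt_le_scaleLattice_of_twoDeep hϖ1 hϖ0 hγ2 hd g hlev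

/-- **PARENT-LAW SPELLING, depth one**: for `γ ∈ U(σ, J₀)` with `|γ − 1| ≤ |ϖ|²` and a vertex `w` of the `J₀`-graph with `LEV[w] ϖ`: `LEV₃[w](ϖ⁴)` — the `hnil` of ★ ROW-R ∕
ROW-C. [cite: Kottwitz1986, §3] [cite: Serre1980Trees, II.1.1] -/
theorem map_sub_one_pow_three_le_scaleLattice_of_twoDeep_of_lev {σ : K →+* K} {ϖ : K} (hϖ : Valued.v ϖ = WithZero.exp (-1 : ℤ))
    (γ : unitaryGroupOfForm σ ((StdForm.antidiagonal 3).over K))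
    (hγ2 : ∀ i j, Valued.v ((((γ : GL (Fin 3) K) : Matrix (Fin 3) (Fin 3) K) - 1) i j) ≤ Valued.v ϖ ^ 2)
    (w : {M : Submodule 𝒪[K] (Fin 3 → K) // IsVertex σ ϖ ((StdForm.antidiagonal 3).over K) M})
    (hlev : w.1.map ((Matrix.toLin' (((γ : GL (Fin 3) K) : Matrix (Fin 3) (Fin 3) K) - 1)).restrictScalars 𝒪[K]) ≤ scaleLattice ϖ w.1) :
    w.1.map ((Matrix.toLin' ((((γ : GL (Fin 3) K) : Matrix (Fin 3) (Fin 3) K) - 1) ^ 3)).restrictScalars 𝒪[K]) ≤ scaleLattice (ϖ ^ 4) w.1 := by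
  have h := map_sub_one_pow_three_le_scaleLattice_of_twoDeep_of_isVertex hϖ hγ2 (d := 1) le_rfl w.2 (by rw [pow_one]; exact hlev)
  exact h

/-- **PARENT-LAW SPELLING, depth zero**: for `γ ∈ U(σ, J₀)` with `|γ − 1| ≤ |ϖ|²` and a vertex `w` of the `J₀`-graph FIXED by `γ`: `LEV₃[w] ϖ` — the `hnil` of ★
`fixedGrandchildren_eq_empty_of_levelZero` (a fixed vertex has `LEV(ϖ⁰)`). [cite: Kottwitz1986, §3] [cite: Serre1980Trees, II.1.1] -/
theorem map_sub_one_pow_three_le_scaleLattice_of_twoDeep_of_fixed {σ : K →+* K} {ϖ : K} (hϖ : Valued.v ϖ = WithZero.exp (-1 : ℤ))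
    (γ : unitaryGroupOfForm σ ((StdForm.antidiagonal 3).over K))
    (hγ2 : ∀ i j, Valued.v ((((γ : GL (Fin 3) K) : Matrix (Fin 3) (Fin 3) K) - 1) i j) ≤ Valued.v ϖ ^ 2)
    {w : {M : Submodule 𝒪[K] (Fin 3 → K) // IsVertex σ ϖ ((StdForm.antidiagonal 3).over K) M}}
    (hfix : latticeGraphIso σ ϖ ((StdForm.antidiagonal 3).over K) γ w = w) :
    w.1.map ((Matrix.toLin' ((((γ : GL (Fin 3) K) : Matrix (Fin 3) (Fin 3) K) - 1) ^ 3)).restrictScalars 𝒪[K]) ≤ scaleLattice ϖ w.1 := by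
  -- a fixed vertex has `LEV(ϖ⁰)`
  have hlev0 : w.1.map ((Matrix.toLin' (((γ : GL (Fin 3) K) : Matrix (Fin 3) (Fin 3) K) - 1)).restrictScalars 𝒪[K]) ≤ scaleLattice (ϖ ^ 0) w.1 := by
    have hfix' : mapGL (γ : GL (Fin 3) K) w.1 = w.1 := congrArg Subtype.val hfix
    rintro _ ⟨x, hx, rfl⟩
    rw [pow_zero, scaleLattice, Submodule.mem_map]
    refine ⟨((γ : GL (Fin 3) K) : Matrix (Fin 3) (Fin 3) K) *ᵥ x - x, w.1.sub_mem ?_ hx, ?_⟩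
    · have hmem : ((γ : GL (Fin 3) K) : Matrix (Fin 3) (Fin 3) K) *ᵥ x ∈ mapGL (γ : GL (Fin 3) K) w.1 :=
        Submodule.mem_map_of_mem (f := ((Matrix.toLin' ((γ : GL (Fin 3) K) : Matrix (Fin 3) (Fin 3) K)).restrictScalars 𝒪[K])) hx
      rwa [hfix'] at hmem
    · simp
  have h := map_sub_one_pow_three_le_scaleLattice_of_twoDeep_of_isVertex hϖ hγ2 (d := 0) (by norm_num) w.2 hlev0
  rwa [show 3 * 0 + 1 = 1 from rfl, pow_one] at h

end Literature.NumberTheory.Automorphic.UnitaryLatticeTree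

end
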